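import Summits.KontsevichZagierPeriods.KontsevichZagierPeriods.Theorems.FermatIsogenyBetaLinearSectorStubSectorPathsAux
import Literature.NumberTheory.Transcendental.CurvePeriodsTransportProofs
import Literature.NumberTheory.Transcendental.CurvePeriodsEllipticDoublingProofs
import HarnessLib

/-!
# `BetaLinearSector` (stmt-KontsevichZagierPeriods-3897), line `fermat-sector-transport`:
# auxiliaries for SECTOR STUB T1 `stub_transportInvX` (transport along `g₂(x,y) = (1/x, εy/x)`)

The birational automorphism `g₂(x, y) = (1/x, εy/x)` (`ε = e^{iπ/N}`, `ε^N = −1`) of the affine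
Fermat curve `F_N = {x^N + y^N = 1}` is not polynomial on `𝔸²`; to transport period symbols along it
by the functoriality relation (R4) of `CurvePeriods.lean` we pass through the auxiliary curve

  `Z_N = {x^N + y^N = 1, xu = 1} ⊂ 𝔸³`  (the graph of `u = 1/x` over `F_N ∖ {x = 0}`)

with the two POLYNOMIAL maps `p = (x, y)`, `q = (u, εyu) : Z_N → F_N` (`g₂ = q ∘ p⁻¹`). This file
proves:

* `Z_N` is a smooth affine curve over `ℚ̄` whenever `F_N` is
  (`transportInvX_isSmoothAffineCurve_aux`): equations over `ℚ`; the gradients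
  `(N x^{N−1}, N y^{N−1}, 0)`, `(u, 0, x)` are independent at every point (`x ≠ 0`); no isolated
  points, because `F_N` has none and `(x, y) ↦ (x, y, 1/x)` is continuous near `x ≠ 0`;
* `p`, `q` are defined over `ℚ̄` (`ε` is algebraic) and map `Z_N` into `F_N`
  (`u^N + (εyu)^N = u^N (1 − y^N) = (xu)^N = 1`);
* THE FORM IDENTITY (`transportInvX_vanishesOn`): for Rohrlich's forms
  `ω_{r,s} = x^{r−1} y^s dx − x^r y^{s−1} dy` and `r + s + t = N`, the polynomial 1-form
  `V = p^*ω_{r,s} − ε̄^s q^*ω_{t,s}` vanishes on the tangent lines of `Z_N`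
  (i.e. `g₂^*ω_{t,s} = ε^s ω_{r,s}` in `Ω¹`): at `(x, y, u) ∈ Z_N`,
  `V = (x^{r−1}y^s, −x^r y^{s−1} + u^{s+t} y^{s−1}, 0)` and for a tangent vector `v`,
  `x^N · V(v) = x^r y^s (x^{N−1} v₀ + y^{N−1} v₁) = 0`.

The scalar `ε` enters only through `q_e = (u, e y u)` with `e^N = −1`, `e ē = 1`, so the algebra is
stated for an arbitrary `e : ℂ`.

References: B. Gross (appendix by D. Rohrlich), *On the periods of abelian integrals and a formula
of Chowla and Selberg*, Invent. Math. 45 (1978), §1; A. Huber, G. Wüstholz, *Transcendence and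
Linear Relations of 1-Periods* (2022), §3.3.1, §13.1 (B). Folklore algebra and calculus; no
definition, no named fact, no notation. Template: `CurvePeriodsEllipticDoublingProofs.lean`
(`Ell.curve2`, `Ell.smooth2`, `Ell.formPullback_pair`).
-/

noncomputable section

open scoped BigOperators Topology
open Set MvPolynomial Filter
open Literature.NumberTheory.Transcendental Literature.NumberTheory.Transcendental.CurvePeriods

namespace Summit.KontsevichZagierPeriods.FermatIsogeny.BetaLinearSector

/-! ## The auxiliary curve `Z_N = {x^N + y^N = 1, xu = 1} ⊂ 𝔸³` -/

/-- `z ∈ Z_N ↔ z₀^N + z₁^N = 1 ∧ z₀ z₂ = 1`. [folklore] -/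
theorem transportInvX_mem_aux_iff (N : ℕ) (z : Fin 3 → ℂ) :
    z ∈ (⟨3, 2, ![X 0 ^ N + X 1 ^ N - 1, X 0 * X 2 - 1]⟩ : CurveData).points ↔
      z 0 ^ N + z 1 ^ N = 1 ∧ z 0 * z 2 = 1 := by
  refine (CurveData.mem_points
    (Z := (⟨3, 2, ![X 0 ^ N + X 1 ^ N - 1, X 0 * X 2 - 1]⟩ : CurveData)) (z := z)).trans ?_
  simp [Fin.forall_fin_two, sub_eq_zero]

/-- The gradient of `x^N + y^N − 1` on `𝔸³`: `(N x^{N−1}, N y^{N−1}, 0)`. [folklore] -/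
theorem transportInvX_gradient_zero (N : ℕ) (z : Fin 3 → ℂ) :
    (⟨3, 2, ![X 0 ^ N + X 1 ^ N - 1, X 0 * X 2 - 1]⟩ : CurveData).gradient 0 z =
      ![(N : ℂ) * z 0 ^ (N - 1), (N : ℂ) * z 1 ^ (N - 1), 0] := by
  funext i
  simp only [CurveData.gradient, Matrix.cons_val_zero]
  fin_cases i <;> simp [Derivation.leibniz_pow, pderiv_X]

/-- The gradient of `xu − 1` on `𝔸³`: `(u, 0, x)`. [folklore] -/
theorem transportInvX_gradient_one (N : ℕ) (z : Fin 3 → ℂ) :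
    (⟨3, 2, ![X 0 ^ N + X 1 ^ N - 1, X 0 * X 2 - 1]⟩ : CurveData).gradient 1 z =
      ![z 2, 0, z 0] := by
  funext i
  simp only [CurveData.gradient, Matrix.cons_val_one]
  fin_cases i <;> simp [pderiv_X]

/-- The tangent line of `Z_N` at `z`: `N z₀^{N−1} v₀ + N z₁^{N−1} v₁ = 0` and `z₂ v₀ + z₀ v₂ = 0`.
[folklore] -/
theorem transportInvX_mem_tangentSpace_iff (N : ℕ) (z v : Fin 3 → ℂ) :
    v ∈ (⟨3, 2, ![X 0 ^ N + X 1 ^ N - 1, X 0 * X 2 - 1]⟩ : CurveData).tangentSpace z ↔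
      (N : ℂ) * z 0 ^ (N - 1) * v 0 + (N : ℂ) * z 1 ^ (N - 1) * v 1 = 0 ∧
        z 2 * v 0 + z 0 * v 2 = 0 := by
  simp only [CurveData.tangentSpace, mem_setOf_eq, Fin.forall_fin_two,
    transportInvX_gradient_zero, transportInvX_gradient_one]
  simp [Fin.sum_univ_three]

/-- **`Z_N = {x^N + y^N = 1, xu = 1} ⊂ 𝔸³` is a smooth affine curve over `ℚ̄`** whenever `F_N` is
(`N ≥ 1`): equations over `ℚ`; the gradients `(N x^{N−1}, N y^{N−1}, 0)`, `(u, 0, x)` are linearly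
independent at every point (`x ≠ 0` as `xu = 1`); and `(x, y, u)` is the limit of the points
`(x′, y′, 1/x′)`, `(x′, y′) ∈ F_N ∖ {(x, y)}` near `(x, y)` (no isolated points on `F_N`).
[cite: HuberWustholz2022, §3.3.1] -/
theorem transportInvX_isSmoothAffineCurve_aux {N : ℕ} (hN : 1 ≤ N)
    (hZ : (⟨2, 1, ![X 0 ^ N + X 1 ^ N - 1]⟩ : CurveData).IsSmoothAffineCurve) :
    (⟨3, 2, ![X 0 ^ N + X 1 ^ N - 1, X 0 * X 2 - 1]⟩ : CurveData).IsSmoothAffineCurve where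
  algebraic j := by
    fin_cases j
    · simpa using (((hasAlgCoeffs_X (n := 3) 0).pow N).add ((hasAlgCoeffs_X 1).pow N)).sub
        hasAlgCoeffs_one
    · simpa using ((hasAlgCoeffs_X (n := 3) 0).mul (hasAlgCoeffs_X 2)).sub hasAlgCoeffs_one
  rank_eq z hz := by
    rw [transportInvX_mem_aux_iff] at hz
    obtain ⟨-, hu⟩ := hz
    have hx : z 0 ≠ 0 := left_ne_zero_of_mul_eq_one hu
    have hN0 : (N : ℂ) ≠ 0 := Nat.cast_ne_zero.2 (by omega)
    have hfun : (fun j => (⟨3, 2, ![X 0 ^ N + X 1 ^ N - 1, X 0 * X 2 - 1]⟩ : CurveData).gradient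
        j z) = ![![(N : ℂ) * z 0 ^ (N - 1), (N : ℂ) * z 1 ^ (N - 1), 0], ![z 2, 0, z 0]] := by
      funext j
      fin_cases j
      · simpa using transportInvX_gradient_zero N z
      · simpa using transportInvX_gradient_one N z
    have hli : LinearIndependent ℂ
        ![![(N : ℂ) * z 0 ^ (N - 1), (N : ℂ) * z 1 ^ (N - 1), 0], ![z 2, 0, z 0]] := by
      rw [LinearIndependent.pair_iff]
      intro a b hab
      have h0 := congrFun hab 0
      have h2 := congrFun hab 2
      simp only [Pi.add_apply, Pi.smul_apply, Matrix.cons_val_zero, Matrix.head_cons,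
        smul_eq_mul, mul_zero, zero_add, Pi.zero_apply, Matrix.cons_val_two,
        Matrix.tail_cons] at h0 h2
      have hb : b = 0 := (mul_eq_zero.1 h2).resolve_right hx
      rw [hb, zero_mul, add_zero] at h0
      refine ⟨?_, hb⟩
      rcases mul_eq_zero.1 h0 with h | h
      · exact h
      · exact absurd (eq_zero_of_pow_eq_zero ((mul_eq_zero.1 h).resolve_left hN0)) hx
    rw [hfun, finrank_span_eq_card hli]
    rfl
  not_isolated z hz := by
    rw [transportInvX_mem_aux_iff] at hz
    obtain ⟨hF, hu⟩ := hz
    have hx : z 0 ≠ 0 := left_ne_zero_of_mul_eq_one hu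
    have hu' : z 2 = (z 0)⁻¹ := eq_inv_of_mul_eq_one_right hu
    -- the point `(x, y)` of `F_N` and the map `(x′, y′) ↦ (x′, y′, 1/x′)`
    obtain ⟨w₀, hw₀⟩ : ∃ w₀ : Fin 2 → ℂ, w₀ = ![z 0, z 1] := ⟨_, rfl⟩
    obtain ⟨φ, hφ⟩ : ∃ φ : (Fin 2 → ℂ) → (Fin 3 → ℂ), φ = fun w => ![w 0, w 1, (w 0)⁻¹] :=
      ⟨_, rfl⟩
    have hw₀F : w₀ ∈ (⟨2, 1, ![X 0 ^ N + X 1 ^ N - 1]⟩ : CurveData).points :=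
      (mem_points_fermat_iff N w₀).2 (by simpa [hw₀] using hF)
    have hw₀x : w₀ 0 ≠ 0 := by simpa [hw₀] using hx
    have hφw₀ : φ w₀ = z := by
      funext i
      fin_cases i
      · simp [hφ, hw₀]
      · simp [hφ, hw₀]
      · simp [hφ, hw₀, hu']
    have hφc : ContinuousAt φ w₀ := by
      rw [hφ]
      refine continuousAt_pi.2 fun i => ?_
      fin_cases i
      · simpa using (continuous_apply 0).continuousAt
      · simpa using (continuous_apply 1).continuousAt
      · exact ((continuous_apply 0).continuousAt).inv₀ hw₀x
    have hcl := hZ.not_isolated w₀ hw₀F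
    rw [mem_closure_iff_nhdsWithin_neBot] at hcl
    have ht : Tendsto φ (𝓝[(⟨2, 1, ![X 0 ^ N + X 1 ^ N - 1]⟩ : CurveData).points \ {w₀}] w₀)
        (𝓝 z) := by
      have h := hφc.tendsto
      rw [hφw₀] at h
      exact h.mono_left nhdsWithin_le_nhds
    refine mem_closure_of_tendsto ht ?_
    have hopen : ∀ᶠ w in 𝓝 w₀, w 0 ≠ 0 := (continuous_apply 0).continuousAt.eventually_ne hw₀x
    filter_upwards [mem_nhdsWithin_of_mem_nhds hopen, self_mem_nhdsWithin] with w hw0 hw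
    obtain ⟨hwF, hwne⟩ := hw
    refine ⟨(transportInvX_mem_aux_iff N _).2 ⟨?_, ?_⟩, fun h => hwne ?_⟩
    · simpa [hφ] using (mem_points_fermat_iff N w).1 hwF
    · simp [hφ, mul_inv_cancel₀ hw0]
    · -- `φ w = z` forces `w = (x, y)`
      have h0 := congrFun h 0
      have h1 := congrFun h 1
      simp only [hφ, Matrix.cons_val_zero, Matrix.cons_val_one] at h0 h1
      show w = w₀
      funext i
      fin_cases i
      · simpa [hw₀] using h0
      · simpa [hw₀] using h1

/-! ## The maps `p = (x, y)`, `q_e = (u, e y u) : Z_N → F_N` -/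

/-- `p = (x, y)` is defined over `ℚ`. [folklore] -/
theorem transportInvX_hasAlgCoeffs_p :
    ∀ j, HasAlgCoeffs ((![X 0, X 1] : Fin 2 → MvPolynomial (Fin 3) ℂ) j) := by
  intro j
  fin_cases j
  · simpa using hasAlgCoeffs_X (n := 3) 0
  · simpa using hasAlgCoeffs_X (n := 3) 1

/-- `q_e = (u, e y u)` is defined over `ℚ̄` for algebraic `e`. [folklore] -/
theorem transportInvX_hasAlgCoeffs_q {e : ℂ} (he : IsAlgebraic ℚ e) :
    ∀ j, HasAlgCoeffs ((![X 2, C e * X 1 * X 2] : Fin 2 → MvPolynomial (Fin 3) ℂ) j) := by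
  intro j
  fin_cases j
  · simpa using hasAlgCoeffs_X (n := 3) 2
  · simpa using ((hasAlgCoeffs_C he).mul (hasAlgCoeffs_X (n := 3) 1)).mul (hasAlgCoeffs_X 2)

/-- `p(z) = (z₀, z₁)`. [folklore] -/
theorem transportInvX_eval_p (z : Fin 3 → ℂ) :
    (fun j => eval z ((![X 0, X 1] : Fin 2 → MvPolynomial (Fin 3) ℂ) j)) = ![z 0, z 1] := by
  funext j
  fin_cases j <;> simp

/-- `q_e(z) = (z₂, e z₁ z₂)`. [folklore] -/
theorem transportInvX_eval_q (e : ℂ) (z : Fin 3 → ℂ) :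
    (fun j => eval z ((![X 2, C e * X 1 * X 2] : Fin 2 → MvPolynomial (Fin 3) ℂ) j)) =
      ![z 2, e * z 1 * z 2] := by
  funext j
  fin_cases j <;> simp

/-- `p` maps `Z_N` into `F_N`. [folklore] -/
theorem transportInvX_p_mapsTo (N : ℕ) :
    ∀ z ∈ (⟨3, 2, ![X 0 ^ N + X 1 ^ N - 1, X 0 * X 2 - 1]⟩ : CurveData).points,
      (fun j => eval z ((![X 0, X 1] : Fin 2 → MvPolynomial (Fin 3) ℂ) j)) ∈
        (⟨2, 1, ![X 0 ^ N + X 1 ^ N - 1]⟩ : CurveData).points := by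
  intro z hz
  rw [transportInvX_eval_p, mem_points_fermat_iff]
  rw [transportInvX_mem_aux_iff] at hz
  simpa using hz.1

/-- `q_e` maps `Z_N` into `F_N` when `e^N = −1`: `u^N + (e y u)^N = u^N (1 − y^N) = (xu)^N = 1`.
[cite: Gross1978, §1] -/
theorem transportInvX_q_mapsTo {N : ℕ} {e : ℂ} (he : e ^ N = -1) :
    ∀ z ∈ (⟨3, 2, ![X 0 ^ N + X 1 ^ N - 1, X 0 * X 2 - 1]⟩ : CurveData).points,
      (fun j => eval z ((![X 2, C e * X 1 * X 2] : Fin 2 → MvPolynomial (Fin 3) ℂ) j)) ∈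
        (⟨2, 1, ![X 0 ^ N + X 1 ^ N - 1]⟩ : CurveData).points := by
  intro z hz
  rw [transportInvX_eval_q, mem_points_fermat_iff]
  rw [transportInvX_mem_aux_iff] at hz
  obtain ⟨hF, hu⟩ := hz
  have hxu : z 0 ^ N * z 2 ^ N = 1 := by rw [← mul_pow, hu, one_pow]
  simp only [Matrix.cons_val_zero, Matrix.cons_val_one, mul_pow]
  linear_combination (z 1 ^ N * z 2 ^ N) * he - z 2 ^ N * hF + hxu

/-! ## The identity of forms `p^*ω_{r,s} = ε̄^s q^*ω_{t,s}` in `Ω¹(Z_N)` -/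

/-- `Dp(z) v = (v₀, v₁)`. [folklore] -/
theorem transportInvX_pair_p (z v : Fin 3 → ℂ) (j : Fin 2) :
    ∑ i, eval z (pderiv i ((![X 0, X 1] : Fin 2 → MvPolynomial (Fin 3) ℂ) j)) * v i =
      ![v 0, v 1] j := by
  fin_cases j <;> simp [Fin.sum_univ_three, pderiv_X]

/-- `Dq_e(z) v = (v₂, e (z₂ v₁ + z₁ v₂))`. [folklore] -/
theorem transportInvX_pair_q (e : ℂ) (z v : Fin 3 → ℂ) (j : Fin 2) :
    ∑ i, eval z (pderiv i ((![X 2, C e * X 1 * X 2] : Fin 2 → MvPolynomial (Fin 3) ℂ) j)) * v i =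
      ![v 2, e * (z 2 * v 1 + z 1 * v 2)] j := by
  fin_cases j
  · simp [Fin.sum_univ_three, pderiv_X]
  · simp [Fin.sum_univ_three]
    ring

/-- `ω_{r,s}(w) = (w₀^{r−1} w₁^s, −w₀^r w₁^{s−1})`. [cite: Gross1978, §1] -/
theorem transportInvX_eval_omega (r s : ℕ) (w : Fin 2 → ℂ) (j : Fin 2) :
    eval w ((![X 0 ^ (r - 1) * X 1 ^ s, -(X 0 ^ r * X 1 ^ (s - 1))] :
      Fin 2 → MvPolynomial (Fin 2) ℂ) j) =
      ![w 0 ^ (r - 1) * w 1 ^ s, -(w 0 ^ r * w 1 ^ (s - 1))] j := by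
  fin_cases j <;> simp

/-- **The form identity on `Z_N`.** For `r, s, t ≥ 1` with `r + s + t = N` and `e ē = 1`, the form
`V = p^*ω_{r,s} − ē^s q_e^*ω_{t,s}` vanishes on the tangent lines of `Z_N`: at `(x, y, u) ∈ Z_N`,
`V = (x^{r−1} y^s, −x^r y^{s−1} + u^{s+t} y^{s−1}, 0)` (the `du`-components of `q_e^*ω_{t,s}`
cancel), and for a tangent vector `v`, `x^N · V(v) = x^r y^s (x^{N−1} v₀ + y^{N−1} v₁) = 0` using
`xu = 1`, `x^N + y^N = 1`; as `x ≠ 0`, `V(v) = 0`. [cite: Gross1978, §1] -/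
theorem transportInvX_vanishesOn {N r s t : ℕ} (hr : 1 ≤ r) (hs : 1 ≤ s) (ht : 1 ≤ t)
    (hN : r + s + t = N) {e eb : ℂ} (hee : e * eb = 1) :
    VanishesOn (⟨3, 2, ![X 0 ^ N + X 1 ^ N - 1, X 0 * X 2 - 1]⟩ : CurveData)
      (formPullback (![X 0, X 1] : Fin 2 → MvPolynomial (Fin 3) ℂ)
          (![X 0 ^ (r - 1) * X 1 ^ s, -(X 0 ^ r * X 1 ^ (s - 1))] :
            Fin 2 → MvPolynomial (Fin 2) ℂ) -
        eb ^ s • formPullback (![X 2, C e * X 1 * X 2] : Fin 2 → MvPolynomial (Fin 3) ℂ)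
          (![X 0 ^ (t - 1) * X 1 ^ s, -(X 0 ^ t * X 1 ^ (s - 1))] :
            Fin 2 → MvPolynomial (Fin 2) ℂ)) := by
  intro z hz v hv
  rw [transportInvX_mem_aux_iff] at hz
  rw [transportInvX_mem_tangentSpace_iff] at hv
  obtain ⟨hF, hu⟩ := hz
  obtain ⟨hv1, -⟩ := hv
  have hx : z 0 ≠ 0 := left_ne_zero_of_mul_eq_one hu
  have hN0 : (N : ℂ) ≠ 0 := Nat.cast_ne_zero.2 (by omega)
  have hv1' : z 0 ^ (N - 1) * v 0 + z 1 ^ (N - 1) * v 1 = 0 := by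
    have h : (N : ℂ) * (z 0 ^ (N - 1) * v 0 + z 1 ^ (N - 1) * v 1) = 0 := by
      linear_combination hv1
    exact (mul_eq_zero.1 h).resolve_left hN0
  -- expand the pairing `V(z) · v` by the chain rule (names for the maps and the forms first)
  generalize hP : (![X 0, X 1] : Fin 2 → MvPolynomial (Fin 3) ℂ) = P
  generalize hQ : (![X 2, C e * X 1 * X 2] : Fin 2 → MvPolynomial (Fin 3) ℂ) = Q
  generalize hω₁ : (![X 0 ^ (r - 1) * X 1 ^ s, -(X 0 ^ r * X 1 ^ (s - 1))] :
    Fin 2 → MvPolynomial (Fin 2) ℂ) = ω₁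
  generalize hω₂ : (![X 0 ^ (t - 1) * X 1 ^ s, -(X 0 ^ t * X 1 ^ (s - 1))] :
    Fin 2 → MvPolynomial (Fin 2) ℂ) = ω₂
  have e1 : ∀ i, eval z ((formPullback P ω₁ - eb ^ s • formPullback Q ω₂) i) * v i =
      eval z (formPullback P ω₁ i) * v i - eb ^ s * (eval z (formPullback Q ω₂ i) * v i) :=
    fun i => by
      simp only [Pi.sub_apply, Pi.smul_apply, map_sub, smul_eval]
      ring
  rw [Finset.sum_congr rfl fun i _ => e1 i, Finset.sum_sub_distrib, ← Finset.mul_sum,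
    Ell.formPullback_pair, Ell.formPullback_pair]
  subst hP hQ hω₁ hω₂
  rw [transportInvX_eval_p, transportInvX_eval_q]
  simp only [Fin.sum_univ_two, transportInvX_pair_p, transportInvX_pair_q,
    transportInvX_eval_omega, Matrix.cons_val_zero, Matrix.cons_val_one]
  -- exponents: `r = r' + 1`, `s = s' + 1`, `t = t' + 1`, `N = r' + s' + t' + 3`
  obtain ⟨r', rfl⟩ : ∃ r', r = r' + 1 := ⟨r - 1, by omega⟩
  obtain ⟨s', rfl⟩ : ∃ s', s = s' + 1 := ⟨s - 1, by omega⟩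
  obtain ⟨t', rfl⟩ : ∃ t', t = t' + 1 := ⟨t - 1, by omega⟩
  obtain ⟨K, rfl⟩ : ∃ K, N = K + 1 := ⟨N - 1, by omega⟩
  simp only [Nat.add_sub_cancel] at hv1' hF ⊢
  obtain rfl : K = r' + s' + t' + 2 := by omega
  have hes : e ^ (s' + 1) * eb ^ (s' + 1) = 1 := by rw [← mul_pow, hee, one_pow]
  have hxu : z 0 ^ (t' + s' + 2) * z 2 ^ (t' + s' + 2) = 1 := by rw [← mul_pow, hu, one_pow]
  rw [← mul_right_inj' (pow_ne_zero (r' + s' + t' + 2 + 1) hx), mul_zero]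
  simp only [mul_pow]
  linear_combination (z 0 ^ (r' + s' + t' + 2 + 1) * z 1 ^ s' * z 2 ^ (t' + s' + 2) * v 1) * hes +
    (z 0 ^ (r' + 1) * z 1 ^ s' * v 1) * hxu - (z 0 ^ (r' + 1) * z 1 ^ s' * v 1) * hF +
    (z 0 ^ (r' + 1) * z 1 ^ (s' + 1)) * hv1'

end Summit.KontsevichZagierPeriods.FermatIsogeny.BetaLinearSector

end
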